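import Summits.ValiantsHypothesis.ValiantsHypothesis.Theorems.GrenetZeonDualUnipotentThreeHalvesHeavyTopCompositionBound
import Summits.ValiantsHypothesis.ValiantsHypothesis.Theorems.GrenetZeonDualUnipotentThreeHalvesHeavyTopKrylovSeedDefs

/-!
# `GrenetZeon.DualUnipotentThreeHalves` (stmt-ValiantsHypothesis-24318), LINE α `krylov_seed`: THE STRUCTURE CURRENCY OF THE RESEARCH STUB
# S1b — «no small-block structure at scale s» hands out a Jordan–Hölder block form of the pencil with an IRREDUCIBLE block of size > s

Lead prover val-port-2 g2 (skeleton `Cruxes/DualUnipotentThreeHalves/Lines/krylov_seed.lean` rev 3 @8ce4ef592c1f; its only `sorry` is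
S1b `stub_fatBlockWeightLaw : FatBlockWeightLaw`, whose hypothesis is `¬ SmallBlockStructure n m N (Nat.sqrt n)`).  This file turns that
NEGATIVE hypothesis into DATA for whoever attacks S1b: by ✓ port-4 g2's `exists_block_conj` (p648257; composition series of the
`W`-module `ℂ^m`, `W = ℂ·N(0) + N_lin(ℂ^{n×n})`) and ✓ `pencil_blockUpper_of_forall_mem` (p648849), the pencil ALWAYS has a constant change
of basis making it block-upper with IRREDUCIBLE diagonal blocks; if no block-upper form has all blocks `≤ s`, then THIS form has a block of
size `> s` — a FAT IRREDUCIBLE FACTOR, with the conjugation, the level function and the irreducibility clause in hand.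

* `weightThin_of_tops_vanish` — LIGHT pencils (a direction space of dimension `> n` with zero tops, e.g. `d < n² − n`) are trivially
  weight-thin (one level): S1b has content only for `d ≥ n² − n`.
* ★ `exists_fat_irreducible_block` — `¬ SmallBlockStructure n m N s` (δ-unfolded) ⇒ ∃ `T` (top map), `P`, `L`, `lvl` with: `lvl < L ≤ m`,
  every level non-empty, every member of `W` block-upper after `P`, the PENCIL block-upper after `P` (polynomial form), every diagonal
  block irreducible for `W` (verbatim clause of `exists_block_conj`), and a level `t < L` with `s < #{i : lvl i = t}`.

Honest framing.  Bookkeeping (`--supports stmt-ValiantsHypothesis-24318 --as helper`); proves nothing about S1b, C⁺, R2, the crux, 8062 or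
`VP ≠ VNP` — all OPEN / NOT proved. [line α; ✓ p648257; ✓ p648849]
-/

set_option linter.dupNamespace false
set_option autoImplicit false

noncomputable section

namespace Summit.ValiantsHypothesis.ValiantsHypothesis.Theorems.GrenetZeon.KrylovSeed

open MvPolynomial Matrix
open scoped BigOperators
open Summit.ValiantsHypothesis.ValiantsHypothesis.Cruxes.TwoDimCoefficients.DimTwoCases (AffMat IsAffine)
open Summit.ValiantsHypothesis.ValiantsHypothesis.Theorems.GrenetZeon.RadicalSplit (linPart exists_topMap_linPart)
open Summit.ValiantsHypothesis.ValiantsHypothesis.Theorems.GrenetZeon.HeavyTopCompositionBound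
  (exists_block_conj pencil_blockUpper_of_forall_mem)

variable {m : ℕ}

/-- ★ **FAT IRREDUCIBLE FACTOR from «no small-block structure».**  If the affine pencil `N` admits NO constant change of basis making it
block-upper with all blocks of size `≤ s` (the line's `¬ SmallBlockStructure n m N s`, δ-unfolded), then the Jordan–Hölder block form of
its nilpotent space `W = ℂ·N(0) + N_lin(ℂ^{n×n})` (✓ `exists_block_conj`) — which makes the pencil block-upper with IRREDUCIBLE diagonal
blocks — has a block of size `> s`. [this file] -/
theorem exists_fat_irreducible_block {n : ℕ} (N : AffMat n m) (hN : IsAffine N) (s : ℕ)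
    (h : ¬ ∃ (P : (Matrix (Fin m) (Fin m) ℂ)ˣ) (L : ℕ) (lvl : Fin m → ℕ), (∀ i, lvl i < L) ∧
      (∀ i j : Fin m, lvl i < lvl j →
        ((P : Matrix (Fin m) (Fin m) ℂ).map C * N * (↑P⁻¹ : Matrix (Fin m) (Fin m) ℂ).map C :
          Matrix (Fin m) (Fin m) (MvPolynomial (Fin n × Fin n) ℂ)) i j = 0) ∧
      (∀ t, t < L → (Finset.univ.filter fun i => lvl i = t).card ≤ s)) :
    ∃ (T : (Fin n × Fin n → ℂ) →ₗ[ℂ] Matrix (Fin m) (Fin m) ℂ) (_ : ∀ v, T v = linPart N v)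
      (P : (Matrix (Fin m) (Fin m) ℂ)ˣ) (L : ℕ) (lvl : Fin m → ℕ),
      (∀ i, lvl i < L) ∧ L ≤ m ∧ (∀ t, t < L → 0 < (Finset.univ.filter (fun i => lvl i = t)).card) ∧
      (∀ A ∈ (ℂ ∙ N.map (MvPolynomial.eval 0)) ⊔ LinearMap.range T, ∀ i j : Fin m, lvl i < lvl j →
        ((P : Matrix (Fin m) (Fin m) ℂ) * A * (↑P⁻¹ : Matrix (Fin m) (Fin m) ℂ)) i j = 0) ∧
      (∀ i j : Fin m, lvl i < lvl j →
        ((P : Matrix (Fin m) (Fin m) ℂ).map C * N * (↑P⁻¹ : Matrix (Fin m) (Fin m) ℂ).map C :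
          Matrix (Fin m) (Fin m) (MvPolynomial (Fin n × Fin n) ℂ)) i j = 0) ∧
      (∀ t, t < L → ∀ (s' : ℕ) (e : {i : Fin m // lvl i = t} ≃ Fin s') (U : Submodule ℂ (Fin s' → ℂ)),
        (∀ A ∈ (((ℂ ∙ N.map (MvPolynomial.eval 0)) ⊔ LinearMap.range T : Submodule ℂ (Matrix (Fin m) (Fin m) ℂ)) :
            Set (Matrix (Fin m) (Fin m) ℂ)), ∀ x ∈ U,
          (Matrix.reindex e e (((P : Matrix (Fin m) (Fin m) ℂ) * A * (↑P⁻¹ : Matrix (Fin m) (Fin m) ℂ)).toBlock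
            (fun i => lvl i = t) (fun i => lvl i = t))) *ᵥ x ∈ U) →
        U = ⊥ ∨ U = ⊤) ∧
      ∃ t, t < L ∧ s < (Finset.univ.filter fun i => lvl i = t).card := by
  classical
  obtain ⟨T, hT⟩ := exists_topMap_linPart N hN
  obtain ⟨P, L, lvl, hlvl, hLm, hne, hblk, hirr⟩ :=
    exists_block_conj ((((ℂ ∙ N.map (MvPolynomial.eval 0)) ⊔ LinearMap.range T :
      Submodule ℂ (Matrix (Fin m) (Fin m) ℂ)) : Set (Matrix (Fin m) (Fin m) ℂ)))
  have hPW : ∀ A ∈ (ℂ ∙ N.map (MvPolynomial.eval 0)) ⊔ LinearMap.range T, ∀ i j : Fin m, lvl i < lvl j →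
      ((P : Matrix (Fin m) (Fin m) ℂ) * A * (↑P⁻¹ : Matrix (Fin m) (Fin m) ℂ)) i j = 0 := fun A hA => hblk A hA
  have hpoly := pencil_blockUpper_of_forall_mem N T hT P lvl hPW
  refine ⟨T, hT, P, L, lvl, hlvl, hLm, hne, hPW, hpoly, hirr, ?_⟩
  by_contra hfat
  push Not at hfat
  exact h ⟨P, L, lvl, hlvl, hpoly, hfat⟩

/-- **LIGHT PENCILS ARE TRIVIALLY WEIGHT-THIN.**  If some direction space `K` of dimension `> n` has ALL its tops equal to zero (e.g.
`K = ker N_lin` when the top space has dimension `d < n² − n`), the one-level certificate `p = 1`, `lvl ≡ 0`, `r = 0`, `c = 1` gives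
`WeightThin n m N`.  So S1b (like R2) has content only in the FAT regime `d ≥ n² − n`: of the calibration rows ✓ p660306, W₆@(4,6)
(`d = 8 < 12`) and W₉@(5,9) (`d = 19 < 20`) are LIGHT, W₇@(4,7) (`d = 12 = n² − n`) is the genuinely fat one. [this file] -/
theorem weightThin_of_tops_vanish {n : ℕ} (N : AffMat n m) (K : Submodule ℂ (Fin n × Fin n → ℂ))
    (hK : ∀ v ∈ K, linPart N v = 0) (hdim : n < Module.finrank ℂ K) : WeightThin n m N := by
  refine ⟨1, fun _ => 0, 1, 0, 1, K, le_rfl, fun _ => Nat.zero_lt_one, fun i j h => absurd h (by simp), ?_, ?_⟩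
  · intro v hv i j _
    rw [hK v hv, Matrix.mul_zero, Matrix.zero_mul, Matrix.zero_apply]
  · simpa using hdim

end Summit.ValiantsHypothesis.ValiantsHypothesis.Theorems.GrenetZeon.KrylovSeed

end
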